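import Literature.MathematicalPhysics.QuantumLattice.XYOrderInfraredHolds
import Literature.MathematicalPhysics.QuantumLattice.XYOrderDischarges
import Literature.MathematicalPhysics.QuantumLattice.XYOrderGDProofs
import Literature.MathematicalPhysics.QuantumLattice.XYZGroundStateOrderCorrIneq
import Literature.MathematicalPhysics.QuantumLattice.HeisenbergModelProofs
import Literature.MathematicalPhysics.QuantumLattice.HeisenbergModelGlobalRotationProofs
import HarnessLib

/-!
# Helical (Dzyaloshinskii–Moriya) twists of the ferromagnetic quantum XY model

Trunk T-QLATTICE; companion to `XYOrder*.lean` (Kennedy–Lieb–Shastry). Filed by the route review of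
`HubbardSuperconductivity/AposterioriCapRg` (refuter, 2026-08-15) as the mathematics behind the
refutation of the crux `KlsOrderOpenness` (stmt-HubbardSuperconductivity-1314), which lives in
`Summits/…/Theorems/AposterioriCapRgKlsOrderOpennessRefutation.lean` and imports this file.

## Contents

* Single site: the phase matrix `spinTwist n φ = diag(e^{iφk})` (a rotation about the `3`-axis up to
  a phase) with `D S⁺ Dᴴ = e^{-iφ} S⁺`, `D S⁻ Dᴴ = e^{iφ} S⁻`; the spin-`1/2` flip `spinFlipX = σˣ`
  exchanging `S⁺ ↔ S⁻`; `S± = Sˣ ± iSʸ`.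
* Two sites (any finite `Λ`): `xyPair = SˣSˣ' + SʸSʸ'` (the in-plane bond / correlation observable),
  `dmPair = SˣSʸ' - SʸSˣ'` (the Dzyaloshinskii–Moriya term `ẑ·(𝐒 × 𝐒')`), `raiseLowerPair = S⁺S⁻'`,
  `lowerRaisePair = S⁻S⁺'`, with `S⁺S⁻' = X - iY`, `S⁻S⁺' = X + iY`, `X = ½(S⁺S⁻' + S⁻S⁺')`;
  adjoints, supports, covariance under relabelling, `U(1)` invariance `[·, Sᶻ_tot] = 0`, the real
  form `αS⁺S⁻' + ᾱS⁻S⁺' = 2Re α X + 2Im α Y`; the product twist `helixTwist n ψ = ⨂_x D(ψ_x)`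
  (Peierls phases `e^{i(ψ_b-ψ_a)}` on `S⁺_aS⁻_b`) and the global flip `globalFlipX = ⨂σˣ`.
* Loewner bounds `±Sᵅ_a Sᵝ_b ≤ S²` for `a ≠ b` and mixed components, their signed spin-`1/2` form,
  and `|eigenvalues| ≤ 1` from `1 ∓ A ≥ 0`.
* Torus phases: `e^{ip·(x+w)} = e^{ip·x}e^{ip·w}`, `cos(p·x - p·y) = cos(p·(x-y))`, `p·eᵢ = pᵢ`.
* `XYHelix` (spin `1/2`, `d = 2`): for a target pitch `θ⋆` and strength `ε` the commensurate data
  `twistNum θ⋆ L = ⌊Lθ⋆/2π⌋`, `pitch = 2π m_L/L`, `twistMom = (m_L, m_L)`, `gauge x = q_L·x`, the bond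
  coefficient `coef = -(e^{iθ_L}-1)/(2ε)` and the local perturbation
  `wLoc x = Σᵢ (α S⁺_xS⁻_{x+eᵢ} + ᾱ S⁻_xS⁺_{x+eᵢ}) = ε⁻¹Σᵢ[(1-cos θ_L)X - sin θ_L Y]_{x,x+eᵢ}`.
  Main facts: the EXACT gauge identity `xyTorus 2 L 1 + ε Σ_x w_x = R H Rᴴ` (`L ≥ 3`,
  `xyTorus_add_smul_wLoc`); admissibility of `w_x` (range `1`, translation covariant, `U(1)`
  invariant, Hermitian with spectrum in `[-1,1]` once `θ⋆ ≤ ε/4`, `θ⋆ ≤ 1/2`: `wLoc_eigenvalues`);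
  the twisted ground-state correlation `Re ω_ε(X_{xy}) = cos(φ_x-φ_y) Re ω₀(X_{xy})`
  (`re_gsf_twisted_xyPair`, flip symmetry kills the cross term) and its sum
  `Σ_{x,y} Re ω_ε(X_{xy}) = 2L² ĝ⁰(q_L)` (`sum_re_gsf_twisted`); the KLS infrared bound at the twist
  momentum `ĝ⁰(q_L) ≤ 1/(8(1-cos(θ⋆/2))) + 1` (`xyStructureFactor_twistMom_le`, from the tree theorem
  `kls_xy_infraredBound_ground_holds`).

Physically: a uniform DM term of strength `ε` winds the in-plane ferromagnetic order into a spiral of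
pitch `arctan ε`; choosing the pitch commensurate with the torus makes the perturbed model unitarily
equivalent to the unperturbed one, so every ground-state quantity is the KLS quantity seen at the
shifted momentum `q_L`.

## Sources

* T. Kennedy, E. H. Lieb, B. S. Shastry, PRL 61 (1988) 2582 (`KLS1988PRL`): the model, the infrared
  bound (eq. (4)) consumed through `kls_xy_infraredBound_ground_holds`.
* H. Tasaki, *Physics and Mathematics of Quantum Many-Body Systems* (2020), §2.1–2.2: spin operators,
  rotations `e^{-iθSᶻ} S± e^{iθSᶻ} = e^{∓iθ} S±`, `U(1)` symmetry.
* I. Dzyaloshinsky, J. Phys. Chem. Solids 4 (1958) 241; T. Moriya, Phys. Rev. 120 (1960) 91: the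
  antisymmetric exchange `𝐃·(𝐒_a × 𝐒_b)` and the gauge (spiral) transformation removing a uniform
  `D ∥ ẑ` in a `U(1)`-symmetric planar magnet — standard; everything here is finite-dimensional
  matrix algebra and is tagged folklore.

## Design

All operators are the tree's concrete matrices (`Op`, `onSite`, `siteSpin`, `productOp`); the
helix data are plain functions of `(θ⋆, ε, L)`; junk: `twistNum`, `pitch` make sense for every `L`
(`pitch θ⋆ 0 = 0` by `x/0 = 0`), `wLoc` needs `[NeZero L]`. Spin `1/2` (`n = 1`) is fixed only where
the flip `σˣ` or the numerical Loewner constant `S² = 1/4` enter.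
-/

noncomputable section

open Matrix Complex Finset
open scoped ComplexOrder
open Literature.MathematicalPhysics.QuantumLattice Literature.Probability.LatticeModels

namespace Literature.MathematicalPhysics.QuantumLattice

/-! ### Single-site twist `D(φ) = diag(e^{iφk})` -/

/-- The diagonal phase matrix `D(φ) = diag(e^{iφk})_{k=0..n}` (a rotation about the `3`-axis up to
a phase). [folklore] -/
def spinTwist (n : ℕ) (φ : ℝ) : Matrix (Fin (n + 1)) (Fin (n + 1)) ℂ :=
  diagonal fun k => Complex.exp ((φ : ℂ) * I) ^ (k : ℕ)

/-- `conj e^{iφ} = e^{-iφ}`. [folklore] -/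
lemma star_cexp_mul_I (φ : ℝ) : star (Complex.exp ((φ : ℂ) * I)) = Complex.exp ((((-φ : ℝ)) : ℂ) * I) := by
  rw [Complex.star_def, ← Complex.exp_conj, map_mul, Complex.conj_ofReal, Complex.conj_I]
  push_cast
  ring_nf

/-- `e^{iφk} · conj(e^{iφk}) = 1`. [folklore] -/
lemma cexp_mul_star_self (φ : ℝ) (k : ℕ) :
    Complex.exp ((φ : ℂ) * I) ^ k * star (Complex.exp ((φ : ℂ) * I) ^ k) = 1 := by
  rw [star_pow, ← mul_pow, star_cexp_mul_I, ← Complex.exp_add]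
  push_cast
  ring_nf
  rw [Complex.exp_zero, one_pow]

/-- `e^{iφk} · conj(e^{iφ(k+1)}) = e^{-iφ}`. [folklore] -/
lemma cexp_mul_star_succ (φ : ℝ) (k : ℕ) :
    Complex.exp ((φ : ℂ) * I) ^ k * star (Complex.exp ((φ : ℂ) * I) ^ (k + 1)) =
      Complex.exp ((((-φ : ℝ)) : ℂ) * I) := by
  rw [star_pow, pow_succ, ← mul_assoc, ← star_pow, cexp_mul_star_self, one_mul, star_cexp_mul_I]

/-- `D(φ) D(φ)ᴴ = 1`. [folklore] -/
theorem spinTwist_mul_conjTranspose (n : ℕ) (φ : ℝ) : spinTwist n φ * (spinTwist n φ)ᴴ = 1 := by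
  rw [spinTwist, diagonal_conjTranspose, diagonal_mul_diagonal, ← diagonal_one]
  congr 1
  funext k
  exact cexp_mul_star_self φ k

/-- `D(φ)ᴴ D(φ) = 1`. [folklore] -/
theorem spinTwist_conjTranspose_mul (n : ℕ) (φ : ℝ) : (spinTwist n φ)ᴴ * spinTwist n φ = 1 := by
  rw [spinTwist, diagonal_conjTranspose, diagonal_mul_diagonal, ← diagonal_one]
  congr 1
  funext k
  rw [mul_comm]
  exact cexp_mul_star_self φ k

/-- `D(φ)ᴴ = D(-φ)`. [folklore] -/
theorem spinTwist_conjTranspose (n : ℕ) (φ : ℝ) : (spinTwist n φ)ᴴ = spinTwist n (-φ) := by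
  rw [spinTwist, spinTwist, diagonal_conjTranspose]
  congr 1
  funext k
  change star (Complex.exp ((φ : ℂ) * I) ^ (k : ℕ)) = _
  rw [star_pow, star_cexp_mul_I]

/-- `D(φ) S⁺ D(φ)ᴴ = e^{-iφ} S⁺`. [folklore] -/
theorem spinTwist_conj_spinRaise (n : ℕ) (φ : ℝ) :
    spinTwist n φ * spinRaise n * (spinTwist n φ)ᴴ = Complex.exp ((((-φ : ℝ)) : ℂ) * I) • spinRaise n := by
  ext k l
  rw [spinTwist, diagonal_mul_mul_conjTranspose_apply, Matrix.smul_apply, spinRaise_apply, smul_eq_mul]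
  split_ifs with h
  · rw [h, mul_right_comm, cexp_mul_star_succ]
  · simp

/-- `D(φ) S⁻ D(φ)ᴴ = e^{iφ} S⁻`. [folklore] -/
theorem spinTwist_conj_spinLower (n : ℕ) (φ : ℝ) :
    spinTwist n φ * spinLower n * (spinTwist n φ)ᴴ = Complex.exp ((φ : ℂ) * I) • spinLower n := by
  have h := congrArg conjTranspose (spinTwist_conj_spinRaise n φ)
  rw [conjTranspose_mul, conjTranspose_mul, conjTranspose_conjTranspose, ← mul_assoc,
    conjTranspose_smul] at h
  rw [spinLower, h]
  congr 1
  rw [star_cexp_mul_I, neg_neg]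

/-! ### The spin flip `σˣ` for spin `1/2` -/

/-- The Pauli matrix `σˣ`. [folklore] -/
def spinFlipX : Matrix (Fin 2) (Fin 2) ℂ := !![0, 1; 1, 0]

/-- `σˣ` is Hermitian. [folklore] -/
theorem spinFlipX_conjTranspose : spinFlipXᴴ = spinFlipX := by
  ext i j; fin_cases i <;> fin_cases j <;> simp [spinFlipX, conjTranspose_apply]

/-- `σˣ σˣ = 1`. [folklore] -/
theorem spinFlipX_mul_self : spinFlipX * spinFlipX = 1 := by
  ext i j; fin_cases i <;> fin_cases j <;> simp [spinFlipX]

/-- `σˣ (σˣ)ᴴ = 1`. [folklore] -/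
theorem spinFlipX_mul_conjTranspose : spinFlipX * spinFlipXᴴ = 1 := by
  rw [spinFlipX_conjTranspose, spinFlipX_mul_self]

/-- `(σˣ)ᴴ σˣ = 1`. [folklore] -/
theorem spinFlipX_conjTranspose_mul : spinFlipXᴴ * spinFlipX = 1 := by
  rw [spinFlipX_conjTranspose, spinFlipX_mul_self]

/-- `S⁺ = !![0, 1; 0, 0]` for spin `1/2`. [folklore] -/
theorem spinRaise_one_eq : spinRaise 1 = !![0, 1; 0, 0] := by
  ext i j
  rw [spinRaise_apply]
  fin_cases i <;> fin_cases j <;> simp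

/-- `S⁻ = !![0, 0; 1, 0]` for spin `1/2`. [folklore] -/
theorem spinLower_one_eq : spinLower 1 = !![0, 0; 1, 0] := by
  rw [spinLower, spinRaise_one_eq]
  ext i j
  fin_cases i <;> fin_cases j <;> simp [conjTranspose_apply]

/-- `σˣ S⁺ σˣ = S⁻` (spin `1/2`). [folklore] -/
theorem spinFlipX_conj_spinRaise : spinFlipX * spinRaise 1 * spinFlipXᴴ = spinLower 1 := by
  rw [spinFlipX_conjTranspose, spinRaise_one_eq, spinLower_one_eq, spinFlipX]
  ext i j
  fin_cases i <;> fin_cases j <;> simp [Matrix.mul_apply, Fin.sum_univ_succ]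

/-- `σˣ S⁻ σˣ = S⁺` (spin `1/2`). [folklore] -/
theorem spinFlipX_conj_spinLower : spinFlipX * spinLower 1 * spinFlipXᴴ = spinRaise 1 := by
  rw [spinFlipX_conjTranspose, spinRaise_one_eq, spinLower_one_eq, spinFlipX]
  ext i j
  fin_cases i <;> fin_cases j <;> simp [Matrix.mul_apply, Fin.sum_univ_succ]

/-! ### `S± = Sˣ ± i Sʸ` -/

/-- `S⁺ = Sˣ + i Sʸ`. Tasaki (2020) §2.1, eq. (2.1.6). [folklore] -/
theorem spinRaise_eq_spinX_add (n : ℕ) : spinRaise n = spinX n + I • spinY n := by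
  rw [spinX, spinY, smul_smul]
  have h : I * (1 / (2 * I)) = (1 / 2 : ℂ) := by field_simp
  rw [h]
  module

/-- `S⁻ = Sˣ - i Sʸ`. Tasaki (2020) §2.1, eq. (2.1.6). [folklore] -/
theorem spinLower_eq_spinX_sub (n : ℕ) : spinLower n = spinX n - I • spinY n := by
  rw [spinX, spinY, smul_smul]
  have h : I * (1 / (2 * I)) = (1 / 2 : ℂ) := by field_simp
  rw [h]
  module

/-! ### Two-site operators on a finite set of sites -/

section TwoSite

variable {Λ : Type*} [Fintype Λ] [DecidableEq Λ]

/-- `S⁺_a` placed at site `a`. [folklore] -/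
abbrev siteRaise (n : ℕ) (a : Λ) : Op Λ (n + 1) := onSite a (spinRaise n)

/-- `S⁻_a` placed at site `a`. [folklore] -/
abbrev siteLower (n : ℕ) (a : Λ) : Op Λ (n + 1) := onSite a (spinLower n)

/-- `X_{ab} = Sˣ_a Sˣ_b + Sʸ_a Sʸ_b` (the in-plane correlation observable of the statement). [folklore] -/
def xyPair (n : ℕ) (a b : Λ) : Op Λ (n + 1) :=
  siteSpin n a 0 * siteSpin n b 0 + siteSpin n a 1 * siteSpin n b 1

/-- `Y_{ab} = Sˣ_a Sʸ_b - Sʸ_a Sˣ_b` (the Dzyaloshinskii–Moriya / helicity operator). [folklore] -/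
def dmPair (n : ℕ) (a b : Λ) : Op Λ (n + 1) :=
  siteSpin n a 0 * siteSpin n b 1 - siteSpin n a 1 * siteSpin n b 0

/-- `P_{ab} = S⁺_a S⁻_b`. [folklore] -/
def raiseLowerPair (n : ℕ) (a b : Λ) : Op Λ (n + 1) := siteRaise n a * siteLower n b

/-- `Q_{ab} = S⁻_a S⁺_b`. [folklore] -/
def lowerRaisePair (n : ℕ) (a b : Λ) : Op Λ (n + 1) := siteLower n a * siteRaise n b

/-- `S⁺_a = Sˣ_a + i Sʸ_a`. [folklore] -/
theorem siteRaise_eq (n : ℕ) (a : Λ) : siteRaise n a = siteSpin n a 0 + I • siteSpin n a 1 := by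
  rw [siteRaise, spinRaise_eq_spinX_add, onSite_add', onSite_smul']
  rfl

/-- `S⁻_a = Sˣ_a - i Sʸ_a`. [folklore] -/
theorem siteLower_eq (n : ℕ) (a : Λ) : siteLower n a = siteSpin n a 0 - I • siteSpin n a 1 := by
  rw [siteLower, spinLower_eq_spinX_sub, onSite_sub', onSite_smul']
  rfl

/-- `P = X - iY`. [folklore] -/
theorem raiseLowerPair_eq (n : ℕ) (a b : Λ) : raiseLowerPair n a b = xyPair n a b - I • dmPair n a b := by
  rw [raiseLowerPair, siteRaise_eq, siteLower_eq, xyPair, dmPair]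
  simp only [mul_sub, add_mul, smul_mul_assoc, mul_smul_comm, smul_sub]
  match_scalars
  · rfl
  · ring
  · rfl
  · rw [← mul_assoc, Complex.I_mul_I]; ring

/-- `Q = X + iY`. [folklore] -/
theorem lowerRaisePair_eq (n : ℕ) (a b : Λ) : lowerRaisePair n a b = xyPair n a b + I • dmPair n a b := by
  rw [lowerRaisePair, siteRaise_eq, siteLower_eq, xyPair, dmPair]
  simp only [mul_add, sub_mul, smul_mul_assoc, mul_smul_comm, smul_sub, smul_smul,
    Complex.I_mul_I]
  module

/-- `X = ½ (P + Q)`. [folklore] -/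
theorem xyPair_eq (n : ℕ) (a b : Λ) : xyPair n a b = (1 / 2 : ℂ) • (raiseLowerPair n a b + lowerRaisePair n a b) := by
  rw [raiseLowerPair_eq, lowerRaisePair_eq]
  module

/-- `spinBond 0 + spinBond 1 = X` on distinct sites. [folklore] -/
theorem spinBond_zero_add_one {n : ℕ} {a b : Λ} (hab : a ≠ b) :
    spinBond n 0 a b + spinBond n 1 a b = xyPair n a b := by
  rw [spinBond, spinBond, xyPair, (siteSpin_commute_of_ne_holds n hab 0 0).eq.symm,
    (siteSpin_commute_of_ne_holds n hab 1 1).eq.symm]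
  module

/-! #### Adjoint, support, translation covariance -/

/-- `(S⁺_a)ᴴ = S⁻_a`. [folklore] -/
theorem siteRaise_conjTranspose (n : ℕ) (a : Λ) : (siteRaise n a)ᴴ = siteLower n a := by
  rw [siteRaise, siteLower, ← onSite_conjTranspose]
  rfl

/-- `(S⁻_a)ᴴ = S⁺_a`. [folklore] -/
theorem siteLower_conjTranspose (n : ℕ) (a : Λ) : (siteLower n a)ᴴ = siteRaise n a := by
  rw [siteRaise, siteLower, ← onSite_conjTranspose, spinLower, conjTranspose_conjTranspose]

/-- `(S⁺_a S⁻_b)ᴴ = S⁻_a S⁺_b` for `a ≠ b`. [folklore] -/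
theorem raiseLowerPair_conjTranspose {n : ℕ} {a b : Λ} (hab : a ≠ b) : (raiseLowerPair n a b)ᴴ = lowerRaisePair n a b := by
  rw [raiseLowerPair, lowerRaisePair, conjTranspose_mul, siteRaise_conjTranspose, siteLower_conjTranspose, siteRaise, siteLower,
    onSite_mul_onSite_comm (Ne.symm hab)]

/-- `(S⁻_a S⁺_b)ᴴ = S⁺_a S⁻_b` for `a ≠ b`. [folklore] -/
theorem lowerRaisePair_conjTranspose {n : ℕ} {a b : Λ} (hab : a ≠ b) : (lowerRaisePair n a b)ᴴ = raiseLowerPair n a b := by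
  rw [← raiseLowerPair_conjTranspose hab, conjTranspose_conjTranspose]

/-- `S⁺_a S⁻_b` is supported on any region containing `a` and `b`. [folklore] -/
theorem isSupportedOn_raiseLowerPair (n : ℕ) {a b : Λ} {X : Finset Λ} (ha : a ∈ X) (hb : b ∈ X) :
    IsSupportedOn (raiseLowerPair n a b) X :=
  IsSupportedOn.mul_holds
    (IsSupportedOn.mono_holds (isSupportedOn_onSite_holds a _) (Finset.singleton_subset_iff.2 ha))
    (IsSupportedOn.mono_holds (isSupportedOn_onSite_holds b _) (Finset.singleton_subset_iff.2 hb))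

/-- `S⁻_a S⁺_b` is supported on any region containing `a` and `b`. [folklore] -/
theorem isSupportedOn_lowerRaisePair (n : ℕ) {a b : Λ} {X : Finset Λ} (ha : a ∈ X) (hb : b ∈ X) :
    IsSupportedOn (lowerRaisePair n a b) X :=
  IsSupportedOn.mul_holds
    (IsSupportedOn.mono_holds (isSupportedOn_onSite_holds a _) (Finset.singleton_subset_iff.2 ha))
    (IsSupportedOn.mono_holds (isSupportedOn_onSite_holds b _) (Finset.singleton_subset_iff.2 hb))

/-- Relabelling sites transports `S⁺_a S⁻_b` (covariance). [folklore] -/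
theorem reindexOp_raiseLowerPair {Λ' : Type*} [Fintype Λ'] [DecidableEq Λ'] (e : Λ ≃ Λ') (n : ℕ) (a b : Λ) :
    reindexOp e (raiseLowerPair n a b) = raiseLowerPair n (e a) (e b) := by
  rw [raiseLowerPair, raiseLowerPair, map_mul, siteRaise, siteLower, reindexOp_onSite, reindexOp_onSite]

/-- Relabelling sites transports `S⁻_a S⁺_b` (covariance). [folklore] -/
theorem reindexOp_lowerRaisePair {Λ' : Type*} [Fintype Λ'] [DecidableEq Λ'] (e : Λ ≃ Λ') (n : ℕ) (a b : Λ) :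
    reindexOp e (lowerRaisePair n a b) = lowerRaisePair n (e a) (e b) := by
  rw [lowerRaisePair, lowerRaisePair, map_mul, siteRaise, siteLower, reindexOp_onSite, reindexOp_onSite]

/-! #### `U(1)` invariance: `[P_{ab}, Sᶻ_tot] = [Q_{ab}, Sᶻ_tot] = 0` -/

/-- `[S⁺_a, Sᶻ_tot] = -S⁺_a` (`S⁺` raises the magnetisation by one). Tasaki (2020) §2.2. [folklore] -/
theorem siteRaise_mul_totalSpin (n : ℕ) (a : Λ) :
    siteRaise n a * totalSpin n 2 = totalSpin n 2 * siteRaise n a - siteRaise n a := by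
  have e1 : ((2 : Fin 3) + 1) = 0 := by decide
  have e2 : ((2 : Fin 3) + 2) = 1 := by decide
  have e3 : ((1 : Fin 3) + 1) = 2 := by decide
  have e4 : ((1 : Fin 3) + 2) = 0 := by decide
  have h02 : ⁅spinVec n 0, spinVec n 2⁆ = -(I • spinVec n 1) := by
    have h := spin_commutation_holds n 2
    rw [e1, e2, Ring.lie_def] at h
    rw [Ring.lie_def, ← neg_sub, h]
  have h12 : ⁅spinVec n 1, spinVec n 2⁆ = I • spinVec n 0 := by
    have h := spin_commutation_holds n 1
    rwa [e3, e4] at h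
  have hx := siteSpin_mul_totalSpin n a 0 2
  have hy := siteSpin_mul_totalSpin n a 1 2
  rw [h02, onSite_neg', onSite_smul'] at hx
  rw [h12, onSite_smul'] at hy
  rw [siteRaise_eq, add_mul, smul_mul_assoc, hx, hy, spinVec_zero, spinVec_one]
  simp only [mul_add, mul_smul_comm, smul_add, smul_smul, Complex.I_mul_I]
  change totalSpin n 2 * siteSpin n a 0 + -(I • siteSpin n a 1) +
      (I • (totalSpin n 2 * siteSpin n a 1) + (-1 : ℂ) • siteSpin n a 0) =
    totalSpin n 2 * siteSpin n a 0 + I • (totalSpin n 2 * siteSpin n a 1) -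
      (siteSpin n a 0 + I • siteSpin n a 1)
  module

/-- `[S⁻_a, Sᶻ_tot] = S⁻_a`. Tasaki (2020) §2.2. [folklore] -/
theorem siteLower_mul_totalSpin (n : ℕ) (a : Λ) :
    siteLower n a * totalSpin n 2 = totalSpin n 2 * siteLower n a + siteLower n a := by
  have h := congrArg conjTranspose (siteRaise_mul_totalSpin n a)
  rw [conjTranspose_mul, conjTranspose_sub, conjTranspose_mul, siteRaise_conjTranspose,
    (totalSpin_isHermitian n 2).eq] at h
  -- h : T * S⁻ = S⁻ * T - S⁻
  rw [h]
  abel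

/-- `[S⁺_a S⁻_b, Sᶻ_tot] = 0`: hopping terms conserve the magnetisation (`U(1)` invariance). [folklore] -/
theorem commute_raiseLowerPair_totalSpin (n : ℕ) (a b : Λ) : Commute (raiseLowerPair n a b) (totalSpin n 2) := by
  change raiseLowerPair n a b * totalSpin n 2 = totalSpin n 2 * raiseLowerPair n a b
  rw [raiseLowerPair, mul_assoc, siteLower_mul_totalSpin, mul_add, ← mul_assoc, siteRaise_mul_totalSpin]
  noncomm_ring

/-- `[S⁻_a S⁺_b, Sᶻ_tot] = 0`. [folklore] -/
theorem commute_lowerRaisePair_totalSpin (n : ℕ) (a b : Λ) : Commute (lowerRaisePair n a b) (totalSpin n 2) := by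
  change lowerRaisePair n a b * totalSpin n 2 = totalSpin n 2 * lowerRaisePair n a b
  rw [lowerRaisePair, mul_assoc, siteRaise_mul_totalSpin, mul_sub, ← mul_assoc, siteLower_mul_totalSpin]
  noncomm_ring

/-! #### Real form `α P + ᾱ Q = 2 Re α · X + 2 Im α · Y` -/

/-- Real form of a Hermitian hopping term: `α S⁺_aS⁻_b + ᾱ S⁻_aS⁺_b = 2 Re α · X_{ab} + 2 Im α · Y_{ab}`. [folklore] -/
theorem smul_raiseLowerPair_add_smul_lowerRaisePair (n : ℕ) (a b : Λ) (α : ℂ) :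
    α • raiseLowerPair n a b + star α • lowerRaisePair n a b =
      ((2 * α.re : ℝ) : ℂ) • xyPair n a b + ((2 * α.im : ℝ) : ℂ) • dmPair n a b := by
  obtain ⟨u, v, rfl⟩ : ∃ u v : ℝ, α = u + v * I := ⟨α.re, α.im, (Complex.re_add_im α).symm⟩
  have hre : ((u : ℂ) + v * I).re = u := by simp
  have him : ((u : ℂ) + v * I).im = v := by simp
  have hs : star ((u : ℂ) + v * I) = u - v * I := by
    rw [Complex.star_def, map_add, map_mul, Complex.conj_ofReal, Complex.conj_ofReal, Complex.conj_I]
    ring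
  rw [hre, him, hs, raiseLowerPair_eq, lowerRaisePair_eq]
  simp only [smul_sub, smul_add, smul_smul]
  push_cast
  match_scalars
  · ring
  · linear_combination (-2 * (v : ℂ)) * Complex.I_sq

/-! #### Loewner bounds `±Sᵅ_a Sᵝ_b ≤ S²` on distinct sites -/

section Loewner

open scoped MatrixOrder

/-- `S²·1 - Sᵅ_a Sᵝ_b ≥ 0` for `a ≠ b` (commuting factors in `[-S, S]`). [folklore] -/
theorem posSemidef_sq_smul_one_sub_mul (n : ℕ) {a b : Λ} (hab : a ≠ b) (α β : Fin 3) :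
    Matrix.PosSemidef
      (((n : ℂ) / 2) ^ 2 • (1 : Op Λ (n + 1)) - siteSpin n a α * siteSpin n b β) := by
  set c : ℂ := (n : ℂ) / 2 with hc
  set A : Op Λ (n + 1) := siteSpin n a α with hA
  set B : Op Λ (n + 1) := siteSpin n b β with hB
  have hAB : Commute A B := siteSpin_commute_of_ne_holds n hab α β
  have hc1 : ∀ M : Op Λ (n + 1), Commute (c • 1) M := fun M => (Commute.one_left M).smul_left c
  have h1 : 0 ≤ (c • 1 - A) * (c • 1 + B) :=
    Commute.mul_nonneg (Matrix.nonneg_iff_posSemidef.mpr (posSemidef_smul_one_sub_siteSpin n a α))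
      (Matrix.nonneg_iff_posSemidef.mpr (posSemidef_smul_one_add_siteSpin n b β))
      ((hc1 _).sub_left ((hc1 A).symm.add_right hAB))
  have h2 : 0 ≤ (c • 1 + A) * (c • 1 - B) :=
    Commute.mul_nonneg (Matrix.nonneg_iff_posSemidef.mpr (posSemidef_smul_one_add_siteSpin n a α))
      (Matrix.nonneg_iff_posSemidef.mpr (posSemidef_smul_one_sub_siteSpin n b β))
      ((hc1 _).add_left ((hc1 A).symm.sub_right hAB))
  have hsum : (c • 1 - A) * (c • 1 + B) + (c • 1 + A) * (c • 1 - B) =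
      (2 : ℂ) • (c ^ 2 • (1 : Op Λ (n + 1)) - A * B) := by
    rw [two_smul]
    simp only [mul_add, add_mul, mul_sub, sub_mul, smul_mul_assoc, mul_smul_comm, one_mul, mul_one,
      smul_add, smul_sub, smul_smul, sq]
    rw [hAB.eq]
    abel
  have h3 : (0 : Op Λ (n + 1)) ≤ (2 : ℂ) • (c ^ 2 • (1 : Op Λ (n + 1)) - A * B) := by
    rw [← hsum]
    exact add_nonneg h1 h2
  have h4 : c ^ 2 • (1 : Op Λ (n + 1)) - A * B =
      (1 / 2 : ℂ) • ((2 : ℂ) • (c ^ 2 • (1 : Op Λ (n + 1)) - A * B)) := by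
    rw [smul_smul]
    norm_num
  rw [h4]
  exact (Matrix.nonneg_iff_posSemidef.mp h3).smul (a := (1 / 2 : ℂ)) (by
    rw [Complex.nonneg_iff]; norm_num)

/-- `S²·1 + Sᵅ_a Sᵝ_b ≥ 0` for `a ≠ b`. [folklore] -/
theorem posSemidef_sq_smul_one_add_mul (n : ℕ) {a b : Λ} (hab : a ≠ b) (α β : Fin 3) :
    Matrix.PosSemidef
      (((n : ℂ) / 2) ^ 2 • (1 : Op Λ (n + 1)) + siteSpin n a α * siteSpin n b β) := by
  set c : ℂ := (n : ℂ) / 2 with hc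
  set A : Op Λ (n + 1) := siteSpin n a α with hA
  set B : Op Λ (n + 1) := siteSpin n b β with hB
  have hAB : Commute A B := siteSpin_commute_of_ne_holds n hab α β
  have hc1 : ∀ M : Op Λ (n + 1), Commute (c • 1) M := fun M => (Commute.one_left M).smul_left c
  have h1 : 0 ≤ (c • 1 + A) * (c • 1 + B) :=
    Commute.mul_nonneg (Matrix.nonneg_iff_posSemidef.mpr (posSemidef_smul_one_add_siteSpin n a α))
      (Matrix.nonneg_iff_posSemidef.mpr (posSemidef_smul_one_add_siteSpin n b β))
      ((hc1 _).add_left ((hc1 A).symm.add_right hAB))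
  have h2 : 0 ≤ (c • 1 - A) * (c • 1 - B) :=
    Commute.mul_nonneg (Matrix.nonneg_iff_posSemidef.mpr (posSemidef_smul_one_sub_siteSpin n a α))
      (Matrix.nonneg_iff_posSemidef.mpr (posSemidef_smul_one_sub_siteSpin n b β))
      ((hc1 _).sub_left ((hc1 A).symm.sub_right hAB))
  have hsum : (c • 1 + A) * (c • 1 + B) + (c • 1 - A) * (c • 1 - B) =
      (2 : ℂ) • (c ^ 2 • (1 : Op Λ (n + 1)) + A * B) := by
    rw [two_smul]
    simp only [mul_add, add_mul, mul_sub, sub_mul, smul_mul_assoc, mul_smul_comm, one_mul, mul_one,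
      smul_add, smul_sub, smul_smul, sq]
    rw [hAB.eq]
    abel
  have h3 : (0 : Op Λ (n + 1)) ≤ (2 : ℂ) • (c ^ 2 • (1 : Op Λ (n + 1)) + A * B) := by
    rw [← hsum]
    exact add_nonneg h1 h2
  have h4 : c ^ 2 • (1 : Op Λ (n + 1)) + A * B =
      (1 / 2 : ℂ) • ((2 : ℂ) • (c ^ 2 • (1 : Op Λ (n + 1)) + A * B)) := by
    rw [smul_smul]
    norm_num
  rw [h4]
  exact (Matrix.nonneg_iff_posSemidef.mp h3).smul (a := (1 / 2 : ℂ)) (by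
    rw [Complex.nonneg_iff]; norm_num)

/-- Signed version for spin `1/2`: `(|c|/4)·1 - c·Sᵅ_a Sᵝ_b ≥ 0` for real `c` and `a ≠ b`.
[folklore] -/
theorem posSemidef_abs_smul_one_sub_smul_mul {a b : Λ} (hab : a ≠ b) (α β : Fin 3) (c : ℝ) :
    Matrix.PosSemidef
      (((|c| / 4 : ℝ) : ℂ) • (1 : Op Λ 2) - (c : ℂ) • (siteSpin 1 a α * siteSpin 1 b β)) := by
  rcases le_or_gt 0 c with hc | hc
  · have e : ((|c| / 4 : ℝ) : ℂ) • (1 : Op Λ 2) - (c : ℂ) • (siteSpin 1 a α * siteSpin 1 b β) =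
        (c : ℂ) • ((((1 : ℕ) : ℂ) / 2) ^ 2 • (1 : Op Λ 2) - siteSpin 1 a α * siteSpin 1 b β) := by
      rw [abs_of_nonneg hc, smul_sub, smul_smul]
      push_cast
      module
    rw [e]
    exact (posSemidef_sq_smul_one_sub_mul 1 hab α β).smul (Complex.zero_le_real.2 hc)
  · have e : ((|c| / 4 : ℝ) : ℂ) • (1 : Op Λ 2) - (c : ℂ) • (siteSpin 1 a α * siteSpin 1 b β) =
        ((-c : ℝ) : ℂ) • ((((1 : ℕ) : ℂ) / 2) ^ 2 • (1 : Op Λ 2) + siteSpin 1 a α * siteSpin 1 b β) := by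
      rw [abs_of_neg hc, smul_add, smul_smul]
      push_cast
      module
    rw [e]
    exact (posSemidef_sq_smul_one_add_mul 1 hab α β).smul (Complex.zero_le_real.2 (by linarith))

end Loewner

/-! #### The many-body twist `R_ψ = ⨂_x D(ψ_x)` and the global flip `F = ⨂_x σˣ` -/

/-- The site-dependent twist `R_ψ = ⨂_x D(ψ_x)`. [folklore] -/
def helixTwist (n : ℕ) (ψ : Λ → ℝ) : Op Λ (n + 1) := productOp fun x => spinTwist n (ψ x)

/-- `R_ψ R_ψᴴ = 1`. [folklore] -/
theorem helixTwist_mul_conjTranspose (n : ℕ) (ψ : Λ → ℝ) : helixTwist n ψ * (helixTwist n ψ)ᴴ = 1 :=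
  productOp_mul_conjTranspose fun x => spinTwist_mul_conjTranspose n (ψ x)

/-- `R_ψᴴ R_ψ = 1`. [folklore] -/
theorem helixTwist_conjTranspose_mul (n : ℕ) (ψ : Λ → ℝ) : (helixTwist n ψ)ᴴ * helixTwist n ψ = 1 :=
  productOp_conjTranspose_mul fun x => spinTwist_conjTranspose_mul n (ψ x)

omit [DecidableEq Λ] in
/-- `R_ψᴴ = R_{-ψ}`. [folklore] -/
theorem helixTwist_conjTranspose (n : ℕ) (ψ : Λ → ℝ) : (helixTwist n ψ)ᴴ = helixTwist n (-ψ) := by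
  rw [helixTwist, helixTwist, productOp_conjTranspose]
  congr 1
  funext x
  rw [spinTwist_conjTranspose, Pi.neg_apply]

/-- `R_ψ S⁺_a R_ψᴴ = e^{-iψ_a} S⁺_a`. Tasaki (2020) §2.1, eq. (2.1.12). [folklore] -/
theorem helixTwist_conj_siteRaise (n : ℕ) (ψ : Λ → ℝ) (a : Λ) :
    helixTwist n ψ * siteRaise n a * (helixTwist n ψ)ᴴ = Complex.exp ((((-ψ a : ℝ)) : ℂ) * I) • siteRaise n a := by
  rw [siteRaise, helixTwist, productOp_conj_onSite (fun x => spinTwist_mul_conjTranspose n (ψ x)) a,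
    spinTwist_conj_spinRaise, onSite_smul']

/-- `R_ψ S⁻_a R_ψᴴ = e^{iψ_a} S⁻_a`. [folklore] -/
theorem helixTwist_conj_siteLower (n : ℕ) (ψ : Λ → ℝ) (a : Λ) :
    helixTwist n ψ * siteLower n a * (helixTwist n ψ)ᴴ = Complex.exp (((ψ a : ℝ) : ℂ) * I) • siteLower n a := by
  rw [siteLower, helixTwist, productOp_conj_onSite (fun x => spinTwist_mul_conjTranspose n (ψ x)) a,
    spinTwist_conj_spinLower, onSite_smul']

/-- `R_ψ S⁺_aS⁻_b R_ψᴴ = e^{i(ψ_b - ψ_a)} S⁺_aS⁻_b`: the twist acts on hopping terms by a Peierls-type phase. [folklore] -/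
theorem helixTwist_conj_raiseLowerPair (n : ℕ) (ψ : Λ → ℝ) (a b : Λ) :
    helixTwist n ψ * raiseLowerPair n a b * (helixTwist n ψ)ᴴ = Complex.exp (((ψ b - ψ a : ℝ) : ℂ) * I) • raiseLowerPair n a b := by
  rw [raiseLowerPair, helixTwist, productOp_conj_mul (fun x => spinTwist_conjTranspose_mul n (ψ x)), ← helixTwist,
    helixTwist_conj_siteRaise, helixTwist_conj_siteLower, smul_mul_smul_comm, ← Complex.exp_add]
  congr 1
  push_cast
  ring_nf

/-- `R_ψ S⁻_aS⁺_b R_ψᴴ = e^{i(ψ_a - ψ_b)} S⁻_aS⁺_b`. [folklore] -/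
theorem helixTwist_conj_lowerRaisePair (n : ℕ) (ψ : Λ → ℝ) (a b : Λ) :
    helixTwist n ψ * lowerRaisePair n a b * (helixTwist n ψ)ᴴ = Complex.exp (((ψ a - ψ b : ℝ) : ℂ) * I) • lowerRaisePair n a b := by
  rw [lowerRaisePair, helixTwist, productOp_conj_mul (fun x => spinTwist_conjTranspose_mul n (ψ x)), ← helixTwist,
    helixTwist_conj_siteRaise, helixTwist_conj_siteLower, smul_mul_smul_comm, ← Complex.exp_add]
  congr 1
  push_cast
  ring_nf

/-- The global spin flip `F = ⨂_x σˣ` (spin `1/2`). [folklore] -/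
def globalFlipX : Op Λ 2 := productOp fun _ : Λ => spinFlipX

/-- `F Fᴴ = 1`. [folklore] -/
theorem globalFlipX_mul_conjTranspose : (globalFlipX : Op Λ 2) * globalFlipXᴴ = 1 :=
  productOp_mul_conjTranspose fun _ => spinFlipX_mul_conjTranspose

/-- `Fᴴ F = 1`. [folklore] -/
theorem globalFlipX_conjTranspose_mul : (globalFlipX : Op Λ 2)ᴴ * globalFlipX = 1 :=
  productOp_conjTranspose_mul fun _ => spinFlipX_conjTranspose_mul

/-- `F S⁺_a Fᴴ = S⁻_a`. [folklore] -/
theorem globalFlipX_conj_siteRaise (a : Λ) : globalFlipX * siteRaise 1 a * globalFlipXᴴ = siteLower 1 a := by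
  rw [siteRaise, globalFlipX, productOp_conj_onSite (fun _ => spinFlipX_mul_conjTranspose) a, spinFlipX_conj_spinRaise]

/-- `F S⁻_a Fᴴ = S⁺_a`. [folklore] -/
theorem globalFlipX_conj_siteLower (a : Λ) : globalFlipX * siteLower 1 a * globalFlipXᴴ = siteRaise 1 a := by
  rw [siteLower, globalFlipX, productOp_conj_onSite (fun _ => spinFlipX_mul_conjTranspose) a, spinFlipX_conj_spinLower]

/-- `F S⁺_aS⁻_b Fᴴ = S⁻_aS⁺_b`. [folklore] -/
theorem globalFlipX_conj_raiseLowerPair (a b : Λ) : globalFlipX * raiseLowerPair 1 a b * globalFlipXᴴ = lowerRaisePair 1 a b := by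
  rw [raiseLowerPair, lowerRaisePair, globalFlipX, productOp_conj_mul (fun _ => spinFlipX_conjTranspose_mul), ← globalFlipX, globalFlipX_conj_siteRaise,
    globalFlipX_conj_siteLower]

/-- `F S⁻_aS⁺_b Fᴴ = S⁺_aS⁻_b`. [folklore] -/
theorem globalFlipX_conj_lowerRaisePair (a b : Λ) : globalFlipX * lowerRaisePair 1 a b * globalFlipXᴴ = raiseLowerPair 1 a b := by
  rw [raiseLowerPair, lowerRaisePair, globalFlipX, productOp_conj_mul (fun _ => spinFlipX_conjTranspose_mul), ← globalFlipX, globalFlipX_conj_siteRaise,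
    globalFlipX_conj_siteLower]

end TwoSite

/-! ### Phases on the discrete torus -/

section Phases

variable {d : ℕ} (L : ℕ) [NeZero L]

/-- `e^{i p·(x+w)} = e^{i p·x} e^{i p·w}` (the character property, through `torusPhase`). [folklore] -/
theorem cexp_torusPhase_add (q x w : TorusSite d L) :
    Complex.exp ((torusPhase L q (x + w) : ℂ) * I) =
      Complex.exp ((torusPhase L q x : ℂ) * I) * Complex.exp ((torusPhase L q w : ℂ) * I) := by
  rw [← torusChar_eq_exp, ← torusChar_eq_exp, ← torusChar_eq_exp, torusChar_add]

/-- `e^{i (p·(x+w) - p·x)} = e^{i p·w}`. [folklore] -/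
theorem cexp_torusPhase_add_sub (q x w : TorusSite d L) :
    Complex.exp (((torusPhase L q (x + w) - torusPhase L q x : ℝ) : ℂ) * I) =
      Complex.exp ((torusPhase L q w : ℂ) * I) := by
  rw [Complex.ofReal_sub, sub_mul, Complex.exp_sub, cexp_torusPhase_add,
    mul_div_cancel_left₀ _ (Complex.exp_ne_zero _)]

/-- `cos (p·x - p·y) = cos (p·(x - y))`. [folklore] -/
theorem cos_torusPhase_sub_torusPhase (q x y : TorusSite d L) :
    Real.cos (torusPhase L q x - torusPhase L q y) = Real.cos (torusPhase L q (x - y)) := by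
  have h := cexp_torusPhase_add_sub L q y (x - y)
  rw [add_sub_cancel] at h
  have h' := congrArg Complex.re h
  rwa [Complex.exp_ofReal_mul_I_re, Complex.exp_ofReal_mul_I_re] at h'

omit [NeZero L] in
/-- `p · eᵢ = pᵢ` (sides `L ≥ 2`). [folklore] -/
theorem torusPhase_single (hL : 2 ≤ L) (q : TorusSite d L) (i : Fin d) :
    torusPhase L q (Pi.single i 1) = latticeMomentum L q i := by
  haveI : Fact (1 < L) := ⟨by omega⟩
  rw [torusPhase, latticeMomentum_apply, Finset.sum_eq_single i]
  · rw [Pi.single_eq_same, ZMod.val_one, Nat.cast_one, mul_one]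
  · intro j _ hj
    rw [Pi.single_eq_of_ne hj, ZMod.val_zero, Nat.cast_zero, mul_zero]
  · intro h; exact absurd (Finset.mem_univ i) h

end Phases

/-! ### The helical perturbation on `(ℤ/Lℤ)²`, spin `1/2` -/

namespace XYHelix

/-- The twist number `m_L = ⌊L θ⋆ / 2π⌋`. [folklore] -/
def twistNum (θs : ℝ) (L : ℕ) : ℕ := ⌊(L : ℝ) * θs / (2 * Real.pi)⌋₊

/-- The pitch `θ_L = 2π m_L / L`. [folklore] -/
def pitch (θs : ℝ) (L : ℕ) : ℝ := 2 * Real.pi * (twistNum θs L : ℝ) / L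

/-- The dual momentum `q_L = (m_L, m_L)`. [folklore] -/
def twistMom (θs : ℝ) (L : ℕ) : TorusSite 2 L := fun _ => (twistNum θs L : ZMod L)

/-- The gauge phases `φ_x = q_L · x`. [folklore] -/
def gauge (θs : ℝ) (L : ℕ) (x : TorusSite 2 L) : ℝ := torusPhase L (twistMom θs L) x

/-- The complex bond coefficient `α = -(e^{iθ_L} - 1)/(2ε)`. [folklore] -/
def coef (ε θs : ℝ) (L : ℕ) : ℂ := -(Complex.exp ((pitch θs L : ℂ) * I) - 1) / (2 * (ε : ℂ))

variable (L : ℕ) [NeZero L]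

/-- The local term `w_x = Σᵢ (α P_{x,x+eᵢ} + ᾱ Q_{x,x+eᵢ})` of the helical perturbation. [folklore] -/
def wLoc (ε θs : ℝ) (x : TorusSite 2 L) : Op (TorusSite 2 L) 2 :=
  ∑ i : Fin 2, (coef ε θs L • raiseLowerPair 1 x (x + Pi.single i 1) +
    star (coef ε θs L) • lowerRaisePair 1 x (x + Pi.single i 1))

/-- `m_L < L` (for `0 ≤ θ⋆ ≤ 1/2`). [folklore] -/
theorem twistNum_lt (θs : ℝ) (hθ : θs ≤ 1 / 2) (hθ' : 0 ≤ θs) (L : ℕ) [NeZero L] :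
    twistNum θs L < L := by
  rw [twistNum]
  refine (Nat.floor_lt (by positivity)).2 ?_
  have hL : (0 : ℝ) < L := by exact_mod_cast Nat.pos_of_ne_zero (NeZero.ne L)
  rw [div_lt_iff₀ (by positivity)]
  nlinarith [Real.pi_gt_three]

/-- The components of `q_L` have representative `m_L`. [folklore] -/
theorem twistMom_val {θs : ℝ} (hθ : θs ≤ 1 / 2) (hθ' : 0 ≤ θs) (i : Fin 2) :
    ((twistMom θs L i : ZMod L)).val = twistNum θs L := by
  rw [twistMom, ZMod.val_natCast, Nat.mod_eq_of_lt (twistNum_lt θs hθ hθ' L)]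

/-- `φ_{eᵢ} = θ_L`. [folklore] -/
theorem gauge_single {θs : ℝ} (hθ : θs ≤ 1 / 2) (hθ' : 0 ≤ θs) (hL : 2 ≤ L) (i : Fin 2) :
    gauge θs L (Pi.single i 1) = pitch θs L := by
  rw [gauge, torusPhase_single L hL, latticeMomentum_apply, twistMom_val L hθ hθ', pitch]

/-- `e^{i(φ_{x+eᵢ} - φ_x)} = e^{iθ_L}`. [folklore] -/
theorem cexp_gauge_step {θs : ℝ} (hθ : θs ≤ 1 / 2) (hθ' : 0 ≤ θs) (hL : 2 ≤ L)
    (x : TorusSite 2 L) (i : Fin 2) :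
    Complex.exp (((gauge θs L (x + Pi.single i 1) - gauge θs L x : ℝ) : ℂ) * I) =
      Complex.exp ((pitch θs L : ℂ) * I) := by
  rw [gauge, gauge, cexp_torusPhase_add_sub, ← gauge, gauge_single L hθ hθ' hL]

/-- `e^{i(φ_x - φ_{x+eᵢ})} = e^{-iθ_L}`. [folklore] -/
theorem cexp_gauge_step' {θs : ℝ} (hθ : θs ≤ 1 / 2) (hθ' : 0 ≤ θs) (hL : 2 ≤ L)
    (x : TorusSite 2 L) (i : Fin 2) :
    Complex.exp (((gauge θs L x - gauge θs L (x + Pi.single i 1) : ℝ) : ℂ) * I) =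
      Complex.exp (-((pitch θs L : ℂ) * I)) := by
  have h := cexp_gauge_step L hθ hθ' hL x i
  have e : ((gauge θs L x - gauge θs L (x + Pi.single i 1) : ℝ) : ℂ) * I =
      -((((gauge θs L (x + Pi.single i 1) - gauge θs L x : ℝ)) : ℂ) * I) := by
    push_cast
    ring
  rw [e, Complex.exp_neg, h, ← Complex.exp_neg]

omit [NeZero L] in
/-- `x + eᵢ ≠ x` on a torus of side `≥ 2`. [folklore] -/
theorem add_single_ne (hL : 2 ≤ L) (x : TorusSite 2 L) (i : Fin 2) : x ≠ x + Pi.single i 1 := by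
  haveI : Fact (1 < L) := ⟨by omega⟩
  intro h
  have := congrFun h i
  rw [Pi.add_apply, Pi.single_eq_same, left_eq_add] at this
  exact one_ne_zero this

/-- **The XY torus Hamiltonian as a directed bond sum**: `H = -Σ_x Σᵢ X_{x,x+eᵢ}` (`L ≥ 3`). [folklore] -/
theorem xyTorus_eq_neg_sum_xyPair (hL : 3 ≤ L) :
    xyTorus 2 L 1 = -∑ x : TorusSite 2 L, ∑ i : Fin 2, xyPair 1 x (x + Pi.single i 1) := by
  rw [xyTorus_eq_bondSum, ← sum_pairs_eq_sum_edgeFinset' L hL, ← Finset.sum_neg_distrib]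
  refine Finset.sum_congr rfl fun x _ => ?_
  rw [← Finset.sum_neg_distrib]
  refine Finset.sum_congr rfl fun i _ => ?_
  rw [Sym2.lift_mk]
  change ((-1 : ℝ) : ℂ) • spinBond 1 0 x (x + Pi.single i 1) +
      ((-1 : ℝ) : ℂ) • spinBond 1 1 x (x + Pi.single i 1) +
      ((0 : ℝ) : ℂ) • spinBond 1 2 x (x + Pi.single i 1) = -xyPair 1 x (x + Pi.single i 1)
  rw [← spinBond_zero_add_one (add_single_ne L (by omega) x i)]
  push_cast
  module

/-- **The gauge identity**: `H + ε W_L = R H Rᴴ` with `R` the commensurate helical twist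
(`L ≥ 3`, `ε ≠ 0`). [folklore] -/
theorem xyTorus_add_smul_wLoc {ε θs : ℝ} (hε : ε ≠ 0) (hθ : θs ≤ 1 / 2) (hθ' : 0 ≤ θs) (hL : 3 ≤ L) :
    xyTorus 2 L 1 + (ε : ℂ) • ∑ x, wLoc L ε θs x =
      helixTwist 1 (gauge θs L) * xyTorus 2 L 1 * (helixTwist 1 (gauge θs L))ᴴ := by
  rw [xyTorus_eq_neg_sum_xyPair L hL, mul_neg, neg_mul, Finset.mul_sum, Finset.sum_mul, Finset.smul_sum,
    neg_add_eq_sub, ← Finset.sum_sub_distrib, ← Finset.sum_neg_distrib]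
  refine Finset.sum_congr rfl fun x _ => ?_
  rw [Finset.mul_sum, Finset.sum_mul, wLoc, Finset.smul_sum, ← Finset.sum_sub_distrib,
    ← Finset.sum_neg_distrib]
  refine Finset.sum_congr rfl fun i _ => ?_
  rw [xyPair_eq, mul_smul_comm, smul_mul_assoc, mul_add, add_mul, helixTwist_conj_raiseLowerPair, helixTwist_conj_lowerRaisePair,
    cexp_gauge_step L hθ hθ' (by omega), cexp_gauge_step' L hθ hθ' (by omega), coef]
  have hε' : (ε : ℂ) ≠ 0 := Complex.ofReal_ne_zero.2 hε
  have hstar : star (-(Complex.exp ((pitch θs L : ℂ) * I) - 1) / (2 * (ε : ℂ))) =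
      -(Complex.exp (-((pitch θs L : ℂ) * I)) - 1) / (2 * (ε : ℂ)) := by
    rw [star_div₀, star_neg, star_sub, star_one, star_mul, Complex.star_def, Complex.conj_ofReal,
      ← Complex.exp_conj, map_mul, Complex.conj_ofReal, Complex.conj_I]
    simp only [map_ofNat]
    ring_nf
  rw [hstar]
  have h1 : (ε : ℂ) * (-(Complex.exp ((pitch θs L : ℂ) * I) - 1) / (2 * (ε : ℂ))) =
      -(1 / 2) * Complex.exp ((pitch θs L : ℂ) * I) + 1 / 2 := by
    field_simp
    ring
  have h2 : (ε : ℂ) * (-(Complex.exp (-((pitch θs L : ℂ) * I)) - 1) / (2 * (ε : ℂ))) =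
      -(1 / 2) * Complex.exp (-((pitch θs L : ℂ) * I)) + 1 / 2 := by
    field_simp
    ring
  simp only [smul_add, smul_smul, h1, h2]
  module

/-! #### Legality of the perturbation: support, covariance, `U(1)` invariance -/

/-- `[w_x, Sᶻ_tot] = 0`: the helical perturbation is `U(1)` invariant. [folklore] -/
theorem commute_wLoc_totalSpin (ε θs : ℝ) (x : TorusSite 2 L) :
    Commute (wLoc L ε θs x) (totalSpin 1 2) := by
  rw [wLoc]
  refine Commute.sum_left _ _ _ fun i _ => Commute.add_left ?_ ?_
  · exact (commute_raiseLowerPair_totalSpin 1 _ _).smul_left _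
  · exact (commute_lowerRaisePair_totalSpin 1 _ _).smul_left _

/-- Translation covariance `τ_v w_x = w_{x+v}`. [folklore] -/
theorem reindexOp_addRight_wLoc (ε θs : ℝ) (x v : TorusSite 2 L) :
    reindexOp (Equiv.addRight v) (wLoc L ε θs x) = wLoc L ε θs (x + v) := by
  rw [wLoc, wLoc, map_sum]
  refine Finset.sum_congr rfl fun i _ => ?_
  rw [map_add, map_smul, map_smul, reindexOp_raiseLowerPair, reindexOp_lowerRaisePair]
  simp only [Equiv.coe_addRight, add_right_comm x (Pi.single i 1) v]

/-- `dist(x, x + eᵢ) ≤ 1` in the torus metric. [folklore] -/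
theorem torusDist_add_single_le (x : TorusSite 2 L) (i : Fin 2) :
    torusDist x (x + Pi.single i 1) ≤ 1 := by
  rw [torusDist, torusNorm, sub_add_cancel_left]
  refine Finset.sup_le fun j _ => ?_
  by_cases hj : j = i
  · subst hj
    rw [Pi.neg_apply, Pi.single_eq_same, ZMod.neg_val, ZMod.val_one_eq_one_mod]
    split_ifs with h
    · exact (min_le_left _ _).trans (Nat.zero_le _)
    · refine (min_le_right _ _).trans ?_
      have h1 : 1 % L ≤ 1 := Nat.mod_le 1 L
      have hL1 : 1 < L := by
        by_contra hc
        push Not at hc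
        have hL : L = 1 := le_antisymm hc (Nat.pos_of_ne_zero (NeZero.ne L))
        subst hL
        exact h (Subsingleton.elim _ _)
      rw [Nat.mod_eq_of_lt hL1]
      omega
  · rw [Pi.neg_apply, Pi.single_eq_of_ne hj, neg_zero, ZMod.val_zero]
    exact (min_le_left _ _).trans (Nat.zero_le _)

/-- `w_x` has range `1`: it is supported on the ball `{x, x ± eᵢ}`. [folklore] -/
theorem isSupportedOn_wLoc (ε θs : ℝ) (x : TorusSite 2 L) :
    IsSupportedOn (wLoc L ε θs x) (torusBall x 1) := by
  rw [wLoc]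
  refine IsSupportedOn.sum _ fun i _ => IsSupportedOn.add (IsSupportedOn.smul ?_ _)
    (IsSupportedOn.smul ?_ _)
  · exact isSupportedOn_raiseLowerPair 1 (mem_torusBall_self x 1)
      (mem_torusBall_iff.2 (torusDist_add_single_le L x i))
  · exact isSupportedOn_lowerRaisePair 1 (mem_torusBall_self x 1)
      (mem_torusBall_iff.2 (torusDist_add_single_le L x i))

/-! #### Eigenvalues from two-sided Loewner bounds -/

/-- If `1 - A ≥ 0` and `1 + A ≥ 0` for a Hermitian matrix `A`, all its eigenvalues lie in
`[-1, 1]`. [folklore] -/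
theorem abs_eigenvalues_le_one {m : Type*} [Fintype m] [DecidableEq m] {A : Matrix m m ℂ}
    (hA : A.IsHermitian) (h1 : (1 - A).PosSemidef) (h2 : (1 + A).PosSemidef) (i : m) :
    |hA.eigenvalues i| ≤ 1 := by
  set v : m → ℂ := ⇑(hA.eigenvectorBasis i) with hv_def
  have hvv : star v ⬝ᵥ v = 1 := by
    have h1 := EuclideanSpace.norm_sq_eq (hA.eigenvectorBasis i)
    rw [hA.eigenvectorBasis.orthonormal.1 i, one_pow] at h1
    rw [dotProduct]
    have : ∀ r, star (v r) * v r = ((‖v r‖ ^ 2 : ℝ) : ℂ) := fun r => by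
      rw [Complex.star_def, Complex.conj_mul', Complex.ofReal_pow]
    simp_rw [Pi.star_apply, this]
    rw [← Complex.ofReal_sum, ← h1, Complex.ofReal_one]
  have hAv : star v ⬝ᵥ (A *ᵥ v) = (hA.eigenvalues i : ℂ) := by
    rw [hv_def, hA.mulVec_eigenvectorBasis i, ← hv_def, dotProduct_smul, hvv, Complex.real_smul,
      mul_one]
  have hup := h1.dotProduct_mulVec_nonneg v
  have hlo := h2.dotProduct_mulVec_nonneg v
  rw [sub_mulVec, dotProduct_sub, one_mulVec, hvv, hAv, Complex.nonneg_iff] at hup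
  rw [add_mulVec, dotProduct_add, one_mulVec, hvv, hAv, Complex.nonneg_iff] at hlo
  simp only [Complex.sub_re, Complex.one_re, Complex.ofReal_re, Complex.add_re] at hup hlo
  rw [abs_le]
  constructor <;> linarith [hup.1, hlo.1]

/-! #### The coefficient in real form; Hermiticity; the Loewner sandwich -/

/-- `α = (1 - cos θ_L)/(2ε) - i sin θ_L/(2ε)`. [folklore] -/
theorem coef_eq {ε : ℝ} (hε : ε ≠ 0) (θs : ℝ) (L : ℕ) :
    coef ε θs L = (((1 - Real.cos (pitch θs L)) / (2 * ε) : ℝ) : ℂ) +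
      (((-Real.sin (pitch θs L)) / (2 * ε) : ℝ) : ℂ) * I := by
  rw [coef, Complex.exp_mul_I, ← Complex.ofReal_cos, ← Complex.ofReal_sin]
  have : (ε : ℂ) ≠ 0 := Complex.ofReal_ne_zero.2 hε
  push_cast
  field_simp
  ring

/-- `2 Re α = (1 - cos θ_L)/ε`. [folklore] -/
theorem two_mul_coef_re {ε : ℝ} (hε : ε ≠ 0) (θs : ℝ) (L : ℕ) :
    2 * (coef ε θs L).re = (1 - Real.cos (pitch θs L)) / ε := by
  rw [coef_eq hε]
  simp only [Complex.add_re, Complex.ofReal_re, Complex.mul_re, Complex.I_re, Complex.ofReal_im,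
    Complex.I_im, mul_zero, mul_one, sub_zero, add_zero]
  field_simp

/-- `2 Im α = -sin θ_L/ε`. [folklore] -/
theorem two_mul_coef_im {ε : ℝ} (hε : ε ≠ 0) (θs : ℝ) (L : ℕ) :
    2 * (coef ε θs L).im = (-Real.sin (pitch θs L)) / ε := by
  rw [coef_eq hε]
  simp only [Complex.add_im, Complex.ofReal_im, Complex.mul_im, Complex.I_re, Complex.ofReal_re,
    Complex.I_im, mul_zero, mul_one, zero_add, add_zero]
  field_simp

/-- The perturbation in real form `w_x = Σᵢ (u X_{x,x+eᵢ} + v Y_{x,x+eᵢ})`,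
`u = (1 - cos θ_L)/ε`, `v = -sin θ_L / ε`. [folklore] -/
theorem wLoc_eq_real {ε : ℝ} (hε : ε ≠ 0) (θs : ℝ) (x : TorusSite 2 L) :
    wLoc L ε θs x = ∑ i : Fin 2,
      ((((1 - Real.cos (pitch θs L)) / ε : ℝ) : ℂ) • xyPair 1 x (x + Pi.single i 1) +
        (((-Real.sin (pitch θs L)) / ε : ℝ) : ℂ) • dmPair 1 x (x + Pi.single i 1)) := by
  rw [wLoc]
  refine Finset.sum_congr rfl fun i _ => ?_
  rw [smul_raiseLowerPair_add_smul_lowerRaisePair, two_mul_coef_re hε, two_mul_coef_im hε]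

/-- `w_x` is Hermitian (sides `≥ 2`). [folklore] -/
theorem wLoc_isHermitian (hL : 2 ≤ L) (ε θs : ℝ) (x : TorusSite 2 L) :
    (wLoc L ε θs x).IsHermitian := by
  rw [IsHermitian, wLoc, conjTranspose_sum]
  refine Finset.sum_congr rfl fun i _ => ?_
  rw [conjTranspose_add, conjTranspose_smul, conjTranspose_smul,
    raiseLowerPair_conjTranspose (add_single_ne L hL x i), lowerRaisePair_conjTranspose (add_single_ne L hL x i),
    star_star, add_comm]

/-- The Loewner sandwich `-(|u|+|v|) ≤ w_x ≤ |u|+|v|`. [folklore] -/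
theorem posSemidef_smul_one_sub_add_wLoc (hL : 2 ≤ L) {ε : ℝ} (hε : ε ≠ 0) (θs : ℝ)
    (x : TorusSite 2 L) :
    Matrix.PosSemidef (((|(1 - Real.cos (pitch θs L)) / ε| + |(-Real.sin (pitch θs L)) / ε| : ℝ) :
        ℂ) • (1 : Op (TorusSite 2 L) 2) - wLoc L ε θs x) ∧
      Matrix.PosSemidef (((|(1 - Real.cos (pitch θs L)) / ε| + |(-Real.sin (pitch θs L)) / ε| :
        ℝ) : ℂ) • (1 : Op (TorusSite 2 L) 2) + wLoc L ε θs x) := by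
  set u : ℝ := (1 - Real.cos (pitch θs L)) / ε with hu
  set v : ℝ := (-Real.sin (pitch θs L)) / ε with hv
  set b0 : TorusSite 2 L := x + Pi.single 0 1 with hb0
  set b1 : TorusSite 2 L := x + Pi.single 1 1 with hb1
  have h0 : x ≠ b0 := add_single_ne L hL x 0
  have h1 : x ≠ b1 := add_single_ne L hL x 1
  have hw : wLoc L ε θs x = (u : ℂ) • (siteSpin 1 x 0 * siteSpin 1 b0 0) +
      (u : ℂ) • (siteSpin 1 x 1 * siteSpin 1 b0 1) + (v : ℂ) • (siteSpin 1 x 0 * siteSpin 1 b0 1) +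
      (-v : ℂ) • (siteSpin 1 x 1 * siteSpin 1 b0 0) +
      ((u : ℂ) • (siteSpin 1 x 0 * siteSpin 1 b1 0) +
      (u : ℂ) • (siteSpin 1 x 1 * siteSpin 1 b1 1) + (v : ℂ) • (siteSpin 1 x 0 * siteSpin 1 b1 1) +
      (-v : ℂ) • (siteSpin 1 x 1 * siteSpin 1 b1 0)) := by
    rw [wLoc_eq_real L hε, Fin.sum_univ_two, ← hu, ← hv, ← hb0, ← hb1, xyPair, xyPair, dmPair, dmPair]
    module
  have habs : ((|u| + |v| : ℝ) : ℂ) = ((|u| / 4 : ℝ) : ℂ) + ((|u| / 4 : ℝ) : ℂ) +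
      ((|v| / 4 : ℝ) : ℂ) + ((|-v| / 4 : ℝ) : ℂ) + (((|u| / 4 : ℝ) : ℂ) + ((|u| / 4 : ℝ) : ℂ) +
      ((|v| / 4 : ℝ) : ℂ) + ((|-v| / 4 : ℝ) : ℂ)) := by
    rw [abs_neg]; push_cast; ring
  constructor
  · have e : ((|u| + |v| : ℝ) : ℂ) • (1 : Op (TorusSite 2 L) 2) - wLoc L ε θs x =
        (((|u| / 4 : ℝ) : ℂ) • 1 - (u : ℂ) • (siteSpin 1 x 0 * siteSpin 1 b0 0)) +
        (((|u| / 4 : ℝ) : ℂ) • 1 - (u : ℂ) • (siteSpin 1 x 1 * siteSpin 1 b0 1)) +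
        (((|v| / 4 : ℝ) : ℂ) • 1 - (v : ℂ) • (siteSpin 1 x 0 * siteSpin 1 b0 1)) +
        (((|-v| / 4 : ℝ) : ℂ) • 1 - ((-v : ℝ) : ℂ) • (siteSpin 1 x 1 * siteSpin 1 b0 0)) +
        ((((|u| / 4 : ℝ) : ℂ) • 1 - (u : ℂ) • (siteSpin 1 x 0 * siteSpin 1 b1 0)) +
        (((|u| / 4 : ℝ) : ℂ) • 1 - (u : ℂ) • (siteSpin 1 x 1 * siteSpin 1 b1 1)) +
        (((|v| / 4 : ℝ) : ℂ) • 1 - (v : ℂ) • (siteSpin 1 x 0 * siteSpin 1 b1 1)) +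
        (((|-v| / 4 : ℝ) : ℂ) • 1 - ((-v : ℝ) : ℂ) • (siteSpin 1 x 1 * siteSpin 1 b1 0))) := by
      rw [hw, habs]
      push_cast
      module
    rw [e]
    exact ((((posSemidef_abs_smul_one_sub_smul_mul h0 0 0 u).add
      (posSemidef_abs_smul_one_sub_smul_mul h0 1 1 u)).add
      (posSemidef_abs_smul_one_sub_smul_mul h0 0 1 v)).add
      (posSemidef_abs_smul_one_sub_smul_mul h0 1 0 (-v))).add
      ((((posSemidef_abs_smul_one_sub_smul_mul h1 0 0 u).add
      (posSemidef_abs_smul_one_sub_smul_mul h1 1 1 u)).add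
      (posSemidef_abs_smul_one_sub_smul_mul h1 0 1 v)).add
      (posSemidef_abs_smul_one_sub_smul_mul h1 1 0 (-v)))
  · have e : ((|u| + |v| : ℝ) : ℂ) • (1 : Op (TorusSite 2 L) 2) + wLoc L ε θs x =
        (((|-u| / 4 : ℝ) : ℂ) • 1 - ((-u : ℝ) : ℂ) • (siteSpin 1 x 0 * siteSpin 1 b0 0)) +
        (((|-u| / 4 : ℝ) : ℂ) • 1 - ((-u : ℝ) : ℂ) • (siteSpin 1 x 1 * siteSpin 1 b0 1)) +
        (((|-v| / 4 : ℝ) : ℂ) • 1 - ((-v : ℝ) : ℂ) • (siteSpin 1 x 0 * siteSpin 1 b0 1)) +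
        (((|v| / 4 : ℝ) : ℂ) • 1 - (v : ℂ) • (siteSpin 1 x 1 * siteSpin 1 b0 0)) +
        ((((|-u| / 4 : ℝ) : ℂ) • 1 - ((-u : ℝ) : ℂ) • (siteSpin 1 x 0 * siteSpin 1 b1 0)) +
        (((|-u| / 4 : ℝ) : ℂ) • 1 - ((-u : ℝ) : ℂ) • (siteSpin 1 x 1 * siteSpin 1 b1 1)) +
        (((|-v| / 4 : ℝ) : ℂ) • 1 - ((-v : ℝ) : ℂ) • (siteSpin 1 x 0 * siteSpin 1 b1 1)) +
        (((|v| / 4 : ℝ) : ℂ) • 1 - (v : ℂ) • (siteSpin 1 x 1 * siteSpin 1 b1 0))) := by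
      rw [hw, habs, abs_neg, abs_neg]
      push_cast
      module
    rw [e]
    exact ((((posSemidef_abs_smul_one_sub_smul_mul h0 0 0 (-u)).add
      (posSemidef_abs_smul_one_sub_smul_mul h0 1 1 (-u))).add
      (posSemidef_abs_smul_one_sub_smul_mul h0 0 1 (-v))).add
      (posSemidef_abs_smul_one_sub_smul_mul h0 1 0 v)).add
      ((((posSemidef_abs_smul_one_sub_smul_mul h1 0 0 (-u)).add
      (posSemidef_abs_smul_one_sub_smul_mul h1 1 1 (-u))).add
      (posSemidef_abs_smul_one_sub_smul_mul h1 0 1 (-v))).add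
      (posSemidef_abs_smul_one_sub_smul_mul h1 1 0 v))

/-! #### Elementary facts about the pitch -/

/-- `0 ≤ θ_L`. [folklore] -/
theorem pitch_nonneg (θs : ℝ) (L : ℕ) : 0 ≤ pitch θs L := by
  rw [pitch]; positivity

/-- `θ_L ≤ θ⋆` (floor). [folklore] -/
theorem pitch_le {θs : ℝ} (hθ' : 0 ≤ θs) : pitch θs L ≤ θs := by
  have hL : (0 : ℝ) < L := by exact_mod_cast Nat.pos_of_ne_zero (NeZero.ne L)
  have hfl : (twistNum θs L : ℝ) ≤ (L : ℝ) * θs / (2 * Real.pi) := Nat.floor_le (by positivity)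
  rw [pitch, div_le_iff₀ hL]
  rw [le_div_iff₀ (by positivity)] at hfl
  nlinarith [Real.pi_gt_three]

/-- The smallness of the perturbation: `|u| + |v| ≤ 1` once `θ⋆ ≤ ε/4`, `θ⋆ ≤ 1/2`. [folklore] -/
theorem helix_small {ε θs : ℝ} (hε : 0 < ε) (hθ : θs ≤ 1 / 2) (hθ' : 0 ≤ θs) (hθε : θs ≤ ε / 4) :
    |(1 - Real.cos (pitch θs L)) / ε| + |(-Real.sin (pitch θs L)) / ε| ≤ 1 := by
  set θ := pitch θs L with hθdef
  have hθ0 : 0 ≤ θ := pitch_nonneg θs L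
  have hθ1 : θ ≤ θs := pitch_le L hθ'
  have hcos : 1 - Real.cos θ ≤ θ ^ 2 / 2 := by linarith [Real.one_sub_sq_div_two_le_cos (x := θ)]
  have hcos' : 0 ≤ 1 - Real.cos θ := by linarith [Real.cos_le_one θ]
  have hsin : |Real.sin θ| ≤ θ := by
    have := Real.abs_sin_le_abs (x := θ); rwa [abs_of_nonneg hθ0] at this
  rw [abs_div, abs_div, abs_of_pos hε, abs_of_nonneg hcos', abs_neg, ← add_div, div_le_one hε]
  nlinarith

/-- Eigenvalues of `w_x` lie in `[-1, 1]` (side `≥ 2`). [folklore] -/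
theorem wLoc_eigenvalues (hL : 2 ≤ L) {ε θs : ℝ} (hε : 0 < ε) (hθ : θs ≤ 1 / 2) (hθ' : 0 ≤ θs)
    (hθε : θs ≤ ε / 4) (x : TorusSite 2 L) :
    ∃ hw : (wLoc L ε θs x).IsHermitian, ∀ i, |hw.eigenvalues i| ≤ 1 := by
  refine ⟨wLoc_isHermitian L hL ε θs x, fun i => abs_eigenvalues_le_one _ ?_ ?_ i⟩
  · set B : ℝ := |(1 - Real.cos (pitch θs L)) / ε| + |(-Real.sin (pitch θs L)) / ε| with hB
    have hB1 : B ≤ 1 := helix_small L hε hθ hθ' hθε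
    have e : (1 : Op (TorusSite 2 L) 2) - wLoc L ε θs x =
        ((1 - B : ℝ) : ℂ) • (1 : Op (TorusSite 2 L) 2) + ((B : ℂ) • 1 - wLoc L ε θs x) := by
      push_cast
      module
    rw [e]
    exact (PosSemidef.one.smul (Complex.zero_le_real.2 (by linarith))).add
      (posSemidef_smul_one_sub_add_wLoc L hL hε.ne' θs x).1
  · set B : ℝ := |(1 - Real.cos (pitch θs L)) / ε| + |(-Real.sin (pitch θs L)) / ε| with hB
    have hB1 : B ≤ 1 := helix_small L hε hθ hθ' hθε
    have e : (1 : Op (TorusSite 2 L) 2) + wLoc L ε θs x =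
        ((1 - B : ℝ) : ℂ) • (1 : Op (TorusSite 2 L) 2) + ((B : ℂ) • 1 + wLoc L ε θs x) := by
      push_cast
      module
    rw [e]
    exact (PosSemidef.one.smul (Complex.zero_le_real.2 (by linarith))).add
      (posSemidef_smul_one_sub_add_wLoc L hL hε.ne' θs x).2

/-! #### Degenerate sides: no twist, no perturbation -/

omit [NeZero L] in
/-- Small sides carry no twist: `m_L = 0` for `L ≤ 12`, `θ⋆ ≤ 1/2`. [folklore] -/
theorem twistNum_eq_zero {θs : ℝ} (hθ : θs ≤ 1 / 2) (hL : L ≤ 12) : twistNum θs L = 0 := by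
  rw [twistNum, Nat.floor_eq_zero, div_lt_one (by positivity)]
  have : (L : ℝ) ≤ 12 := by exact_mod_cast hL
  nlinarith [Real.pi_gt_three]

/-- No twist, no perturbation: `m_L = 0 ⇒ w_x = 0`. [folklore] -/
theorem wLoc_eq_zero_of_twistNum {θs : ℝ} (h : twistNum θs L = 0) (ε : ℝ) (x : TorusSite 2 L) :
    wLoc L ε θs x = 0 := by
  have hc : coef ε θs L = 0 := by
    rw [coef, pitch, h]
    simp
  simp [wLoc, hc]

/-! ### Ground states: the twisted functional is the KLS functional seen at momentum `q_L` -/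

/-- The XY torus Hamiltonian is flip invariant: `F H Fᴴ = H` (`L ≥ 3`). [folklore] -/
theorem globalFlipX_conj_xyTorus (hL : 3 ≤ L) : globalFlipX * xyTorus 2 L 1 * globalFlipXᴴ = xyTorus 2 L 1 := by
  rw [xyTorus_eq_neg_sum_xyPair L hL, mul_neg, neg_mul, Finset.mul_sum, Finset.sum_mul]
  congr 1
  refine Finset.sum_congr rfl fun x _ => ?_
  rw [Finset.mul_sum, Finset.sum_mul]
  refine Finset.sum_congr rfl fun i _ => ?_
  rw [xyPair_eq, mul_smul_comm, smul_mul_assoc, mul_add, add_mul, globalFlipX_conj_raiseLowerPair, globalFlipX_conj_lowerRaisePair,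
    add_comm (lowerRaisePair 1 x _)]

/-- In the XY ground state `ω₀(S⁻_x S⁺_y) = ω₀(S⁺_x S⁻_y)` (flip symmetry). [folklore] -/
theorem gsf_lowerRaisePair_eq_raiseLowerPair (hL : 3 ≤ L) (x y : TorusSite 2 L) :
    (xyTorus 2 L 1).groundStateFunctional (lowerRaisePair 1 x y) =
      (xyTorus 2 L 1).groundStateFunctional (raiseLowerPair 1 x y) := by
  have hUU : (globalFlipX : Op (TorusSite 2 L) 2)ᴴ * globalFlipX = 1 := globalFlipX_conjTranspose_mul
  have hcomm : globalFlipX * xyTorus 2 L 1 = xyTorus 2 L 1 * globalFlipX := by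
    have h := congrArg (· * globalFlipX) (globalFlipX_conj_xyTorus L hL)
    rwa [mul_assoc, hUU, mul_one] at h
  have h := groundStateFunctional_conj_of_commute (xyTorus_isHermitian 2 L 1) hcomm hUU (raiseLowerPair 1 x y)
  rwa [globalFlipX_conj_raiseLowerPair] at h

/-- **The twisted ground-state correlation**: with `H_ε = H + εW_L = R H Rᴴ`,
`Re ω_ε(X_{xy}) = cos(φ_x - φ_y) · Re ω₀(X_{xy})`. [folklore] -/
theorem re_gsf_twisted_xyPair {ε θs : ℝ} (hε : ε ≠ 0) (hθ : θs ≤ 1 / 2) (hθ' : 0 ≤ θs) (hL : 3 ≤ L)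
    (x y : TorusSite 2 L) :
    ((xyTorus 2 L 1 + (ε : ℂ) • ∑ z, wLoc L ε θs z).groundStateFunctional (xyPair 1 x y)).re =
      Real.cos (gauge θs L x - gauge θs L y) *
        ((xyTorus 2 L 1).groundStateFunctional (xyPair 1 x y)).re := by
  set R : Op (TorusSite 2 L) 2 := helixTwist 1 (gauge θs L) with hR
  have hRR : R * Rᴴ = 1 := helixTwist_mul_conjTranspose 1 _
  have hRR' : Rᴴ * R = 1 := helixTwist_conjTranspose_mul 1 _
  rw [xyTorus_add_smul_wLoc L hε hθ hθ' hL, ← hR]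
  have key := groundStateFunctional_unitary_conj (A := xyTorus 2 L 1) hRR hRR' (Rᴴ * xyPair 1 x y * R)
  have hX : R * (Rᴴ * xyPair 1 x y * R) * Rᴴ = xyPair 1 x y := by
    calc R * (Rᴴ * xyPair 1 x y * R) * Rᴴ = (R * Rᴴ) * xyPair 1 x y * (R * Rᴴ) := by
          simp only [mul_assoc]
      _ = xyPair 1 x y := by rw [hRR, one_mul, mul_one]
  rw [hX] at key
  rw [key]
  -- conjugate the observable by the inverse twist
  have hR' : Rᴴ = helixTwist 1 (-gauge θs L) := helixTwist_conjTranspose 1 _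
  have hR'' : R = (helixTwist 1 (-gauge θs L))ᴴ := by rw [helixTwist_conjTranspose, neg_neg]
  have eP : helixTwist 1 (-gauge θs L) * raiseLowerPair 1 x y * (helixTwist 1 (-gauge θs L))ᴴ =
      Complex.exp (((gauge θs L x - gauge θs L y : ℝ) : ℂ) * I) • raiseLowerPair 1 x y := by
    rw [helixTwist_conj_raiseLowerPair]
    congr 3
    simp only [Pi.neg_apply]
    ring
  have eQ : helixTwist 1 (-gauge θs L) * lowerRaisePair 1 x y * (helixTwist 1 (-gauge θs L))ᴴ =
      Complex.exp (-(((gauge θs L x - gauge θs L y : ℝ) : ℂ) * I)) • lowerRaisePair 1 x y := by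
    rw [helixTwist_conj_lowerRaisePair]
    congr 2
    simp only [Pi.neg_apply]
    push_cast
    ring
  rw [hR', hR'', xyPair_eq, mul_smul_comm, smul_mul_assoc, mul_add, add_mul, eP, eQ, map_smul, map_add,
    map_smul, map_smul, gsf_lowerRaisePair_eq_raiseLowerPair L hL, map_smul, map_add, gsf_lowerRaisePair_eq_raiseLowerPair L hL]
  simp only [smul_eq_mul]
  set Δ : ℝ := gauge θs L x - gauge θs L y
  have hcos : Complex.exp ((Δ : ℂ) * I) + Complex.exp (-((Δ : ℂ) * I)) = 2 * (Real.cos Δ : ℂ) := by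
    rw [Complex.ofReal_cos, Complex.two_cos, neg_mul]
  have e : (1 / 2 : ℂ) * (Complex.exp ((Δ : ℂ) * I) * (xyTorus 2 L 1).groundStateFunctional (raiseLowerPair 1 x y) +
      Complex.exp (-((Δ : ℂ) * I)) * (xyTorus 2 L 1).groundStateFunctional (raiseLowerPair 1 x y)) =
      (Real.cos Δ : ℂ) * ((1 / 2 : ℂ) * ((xyTorus 2 L 1).groundStateFunctional (raiseLowerPair 1 x y) +
        (xyTorus 2 L 1).groundStateFunctional (raiseLowerPair 1 x y))) := by
    rw [← add_mul, hcos]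
    ring
  rw [e, Complex.re_ofReal_mul]

/-- `Re ω₀(X_{xy}) = G⁰(x,y) + G¹(x,y)`. [folklore] -/
theorem re_gsf_xyPair (x y : TorusSite 2 L) :
    ((xyTorus 2 L 1).groundStateFunctional (xyPair 1 x y)).re =
      xyGroundCorr 0 L 1 x y + xyGroundCorr 1 L 1 x y := by
  rw [xyPair, map_add, Complex.add_re, xyGroundCorr_of_neZero, xyGroundCorr_of_neZero]

/-- **The twisted `q = 0` order parameter is the KLS structure factor at `q_L`**:
`Σ_{x,y} Re ω_ε(X_{xy}) = 2 L² ĝ⁰_{q_L}`. [folklore] -/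
theorem sum_re_gsf_twisted {ε θs : ℝ} (hε : ε ≠ 0) (hθ : θs ≤ 1 / 2) (hθ' : 0 ≤ θs) (hL : 3 ≤ L) :
    ∑ x : TorusSite 2 L, ∑ y : TorusSite 2 L,
      ((xyTorus 2 L 1 + (ε : ℂ) • ∑ z, wLoc L ε θs z).groundStateFunctional (xyPair 1 x y)).re =
      2 * (L : ℝ) ^ 2 * xyStructureFactor 0 L 1 (twistMom θs L) := by
  have hL0 : (L : ℝ) ≠ 0 := by exact_mod_cast NeZero.ne L
  have hS : ∀ α : Fin 3, ∑ x : TorusSite 2 L, ∑ y : TorusSite 2 L,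
      Real.cos (torusPhase L (twistMom θs L) (x - y)) * xyGroundCorr α L 1 x y =
        (L : ℝ) ^ 2 * xyStructureFactor α L 1 (twistMom θs L) := by
    intro α
    rw [xyStructureFactor_of_neZero, mul_div_cancel₀ _ (pow_ne_zero 2 hL0)]
  have h1 : xyStructureFactor 1 L 1 (twistMom θs L) = xyStructureFactor 0 L 1 (twistMom θs L) := by
    rw [xyStructureFactor_of_neZero, xyStructureFactor_of_neZero]
    simp_rw [show ∀ x y : TorusSite 2 L, xyGroundCorr 1 L 1 x y = xyGroundCorr 0 L 1 x y from
      fun x y => xy_groundCorr_two_eq_one_holds 2 L 1 x y]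
  calc ∑ x : TorusSite 2 L, ∑ y : TorusSite 2 L,
      ((xyTorus 2 L 1 + (ε : ℂ) • ∑ z, wLoc L ε θs z).groundStateFunctional (xyPair 1 x y)).re
      = ∑ x : TorusSite 2 L, ∑ y : TorusSite 2 L,
          (Real.cos (torusPhase L (twistMom θs L) (x - y)) * xyGroundCorr 0 L 1 x y +
            Real.cos (torusPhase L (twistMom θs L) (x - y)) * xyGroundCorr 1 L 1 x y) := by
        refine Finset.sum_congr rfl fun x _ => Finset.sum_congr rfl fun y _ => ?_
        rw [re_gsf_twisted_xyPair L hε hθ hθ' hL, re_gsf_xyPair, gauge, gauge, cos_torusPhase_sub_torusPhase, mul_add]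
    _ = (L : ℝ) ^ 2 * xyStructureFactor 0 L 1 (twistMom θs L) +
          (L : ℝ) ^ 2 * xyStructureFactor 1 L 1 (twistMom θs L) := by
        simp_rw [Finset.sum_add_distrib]
        rw [hS 0, hS 1]
    _ = 2 * (L : ℝ) ^ 2 * xyStructureFactor 0 L 1 (twistMom θs L) := by rw [h1]; ring

end XYHelix

/-! ### The infrared bound at the twist momentum -/

namespace XYHelix

/-- `|e_α| ≤ 1/4` for spin `1/2` (`d = 2`): an average of correlations bounded by `S² = 1/4`.
[folklore] -/
theorem abs_xyBondCorr_le (α : Fin 3) (L : ℕ) [NeZero L] : |xyBondCorr (d := 2) α L 1| ≤ 1 / 4 := by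
  rw [xyBondCorr_of_neZero]
  have hL : (0 : ℝ) < L := by exact_mod_cast Nat.pos_of_ne_zero (NeZero.ne L)
  have hden : (0 : ℝ) < ((2 : ℕ) : ℝ) * (L : ℝ) ^ 2 := by positivity
  rw [abs_div, abs_of_pos hden, div_le_iff₀ hden]
  have hcard : Fintype.card (TorusSite 2 L) = L ^ 2 := by
    simp [ZMod.card]
  calc |∑ x : TorusSite 2 L, ∑ i : Fin 2, xyGroundCorr α L 1 x (x + Pi.single i 1)|
      ≤ ∑ x : TorusSite 2 L, |∑ i : Fin 2, xyGroundCorr α L 1 x (x + Pi.single i 1)| :=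
        Finset.abs_sum_le_sum_abs _ _
    _ ≤ ∑ x : TorusSite 2 L, ∑ i : Fin 2, |xyGroundCorr α L 1 x (x + Pi.single i 1)| :=
        Finset.sum_le_sum fun x _ => Finset.abs_sum_le_sum_abs _ _
    _ ≤ ∑ x : TorusSite 2 L, ∑ i : Fin 2, (1 / 4 : ℝ) := by
        refine Finset.sum_le_sum fun x _ => Finset.sum_le_sum fun i _ => ?_
        have h := xyGroundCorr_abs_le_holds α 2 L 1 x (x + Pi.single i 1)
        norm_num at h
        exact h
    _ = 1 / 4 * (((2 : ℕ) : ℝ) * (L : ℝ) ^ 2) := by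
        rw [Finset.sum_const, Finset.sum_const, Finset.card_univ, Finset.card_univ, Fintype.card_fin,
          hcard]
        simp only [nsmul_eq_mul]
        push_cast
        ring

/-- The twist momentum is a genuine nonzero momentum once `m_L ≥ 1`. [folklore] -/
theorem twistMom_ne_zero {θs : ℝ} (hθ : θs ≤ 1 / 2) (hθ' : 0 ≤ θs) (L : ℕ) [NeZero L]
    (hm : twistNum θs L ≠ 0) : twistMom θs L ≠ 0 := by
  intro h
  have h0 : (twistMom θs L (0 : Fin 2)).val = 0 := by rw [h]; exact ZMod.val_zero
  rw [twistMom_val L hθ hθ'] at h0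
  exact hm h0

/-- The dispersion at the twist momentum is `2(1 - cos θ_L)`. [folklore] -/
theorem dispersion_twistMom {θs : ℝ} (hθ : θs ≤ 1 / 2) (hθ' : 0 ≤ θs) (L : ℕ) [NeZero L] :
    dispersion (latticeMomentum L (twistMom θs L)) = 2 * (1 - Real.cos (pitch θs L)) := by
  rw [dispersion, Fin.sum_univ_two, latticeMomentum_apply, latticeMomentum_apply,
    twistMom_val L hθ hθ', twistMom_val L hθ hθ', pitch]
  ring

/-- **The structure factor at the twist momentum is bounded** (KLS infrared bound, proved in the
tree as `kls_xy_infraredBound_ground_holds`). [Kennedy–Lieb–Shastry 1988, eq. (4)] [folklore] -/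
theorem xyStructureFactor_twistMom_le {θs : ℝ} (hθ : θs ≤ 1 / 2) (hθ0 : 0 < θs) (k : ℕ)
    (hk : 2 ≤ k) [NeZero (2 * k)] (hm : twistNum θs (2 * k) ≠ 0)
    (hpitch : θs / 2 ≤ pitch θs (2 * k)) :
    xyStructureFactor 0 (2 * k) 1 (twistMom θs (2 * k)) ≤
      1 / (8 * (1 - Real.cos (θs / 2))) + 1 := by
  set η : ℝ := 1 - Real.cos (θs / 2) with hη
  have hηpos : 0 < η := by
    have h := Real.cos_lt_cos_of_nonneg_of_le_pi (le_refl 0) (by linarith [Real.pi_gt_three])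
      (by linarith : (0 : ℝ) < θs / 2)
    rw [Real.cos_zero] at h
    linarith
  obtain ⟨hg0, hb⟩ := kls_xy_infraredBound_ground_holds 2 le_rfl 1 le_rfl k hk (twistMom θs (2 * k))
    (twistMom_ne_zero hθ hθ0.le (2 * k) hm)
  set g := xyStructureFactor 0 (2 * k) 1 (twistMom θs (2 * k)) with hg
  -- the right-hand side of the infrared bound is at most `1/4`
  have hrhs : (1 / 4 : ℝ) * ∑ i : Fin 2, (xyBondCorr (d := 2) 0 (2 * k) 1 -
      xyBondCorr (d := 2) 2 (2 * k) 1 * Real.cos (latticeMomentum (2 * k) (twistMom θs (2 * k)) i)) ≤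
      1 / 4 := by
    have h0 := abs_xyBondCorr_le 0 (2 * k)
    have h2 := abs_xyBondCorr_le 2 (2 * k)
    have hterm : ∀ i : Fin 2, xyBondCorr (d := 2) 0 (2 * k) 1 -
        xyBondCorr (d := 2) 2 (2 * k) 1 * Real.cos (latticeMomentum (2 * k) (twistMom θs (2 * k)) i) ≤
        1 / 2 := by
      intro i
      have hc := Real.abs_cos_le_one (latticeMomentum (2 * k) (twistMom θs (2 * k)) i)
      have hprod : |xyBondCorr (d := 2) 2 (2 * k) 1 *
          Real.cos (latticeMomentum (2 * k) (twistMom θs (2 * k)) i)| ≤ 1 / 4 := by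
        rw [abs_mul]
        nlinarith [abs_nonneg (xyBondCorr (d := 2) 2 (2 * k) 1), abs_nonneg
          (Real.cos (latticeMomentum (2 * k) (twistMom θs (2 * k)) i))]
      linarith [(abs_le.1 h0).2, (abs_le.1 hprod).1]
    have hs : ∑ i : Fin 2, (xyBondCorr (d := 2) 0 (2 * k) 1 -
        xyBondCorr (d := 2) 2 (2 * k) 1 * Real.cos (latticeMomentum (2 * k) (twistMom θs (2 * k)) i)) ≤
        1 := by
      rw [Fin.sum_univ_two]; linarith [hterm 0, hterm 1]
    linarith
  have hdisp : 2 * η ≤ dispersion (latticeMomentum (2 * k) (twistMom θs (2 * k))) := by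
    rw [dispersion_twistMom hθ hθ0.le]
    have hpi : pitch θs (2 * k) ≤ Real.pi := by
      linarith [pitch_le (2 * k) hθ0.le, Real.pi_gt_three]
    have hcos := Real.cos_le_cos_of_nonneg_of_le_pi (by linarith : (0 : ℝ) ≤ θs / 2) hpi hpitch
    linarith
  have hg2 : g ^ 2 * (2 * η) ≤ 1 / 4 := by
    calc g ^ 2 * (2 * η) ≤ g ^ 2 * dispersion (latticeMomentum (2 * k) (twistMom θs (2 * k))) :=
          mul_le_mul_of_nonneg_left hdisp (sq_nonneg g)
      _ ≤ 1 / 4 := hb.trans hrhs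
  have hg2' : g ^ 2 ≤ 1 / (8 * η) := by
    rw [le_div_iff₀ (by positivity)]
    linarith
  rcases le_or_gt g 1 with hg1 | hg1
  · have : 0 ≤ 1 / (8 * η) := by positivity
    linarith
  · have : g ≤ g ^ 2 := by nlinarith
    linarith

/-- Large sides carry at least half the target pitch: `θ_L ≥ θ⋆/2` once `L ≥ 4π/θ⋆`. [folklore] -/
theorem half_le_pitch {θs : ℝ} (hθ0 : 0 < θs) (L : ℕ) [NeZero L] (hL : 4 * Real.pi / θs ≤ (L : ℝ)) :
    θs / 2 ≤ pitch θs L := by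
  have hLpos : (0 : ℝ) < L := by exact_mod_cast Nat.pos_of_ne_zero (NeZero.ne L)
  have h1 : (L : ℝ) * θs / (2 * Real.pi) < (twistNum θs L : ℝ) + 1 := Nat.lt_floor_add_one _
  rw [div_lt_iff₀ (by positivity)] at h1
  rw [div_le_iff₀ hθ0] at hL
  rw [pitch, le_div_iff₀ hLpos]
  nlinarith [Real.pi_gt_three]

end XYHelix


end Literature.MathematicalPhysics.QuantumLattice
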